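import Summits.HubbardSuperconductivity.HubbardSuperconductivity.Theses.ParentFirstSMA
import HarnessLib

/-!
# Cruxes #3 and #4 of route `ParentFirstSMA`: the dichotomy `BoundCoherentDWavePairs ∨ DiluteDWavePairsCondense`

Helper for route `ParentFirstSMA` (`--supports stmt-HubbardSuperconductivity-10771`, crux
`DiluteDWavePairsCondense`). The BEC-bridge crux #4 is an implication, for every `U` in the window
`12 ≤ U ≤ 24`, from (a) a uniform half-filled charge gap, (b) uniform two-hole binding and (c)
`d_{x²-y²}` coherence of the bound pair, to `d`-wave pair-field long-range order at some doping.
Its hypotheses (b) and (c) are, word for word, the two clauses of crux #3 `BoundCoherentDWavePairs`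
(`∃ U ∈ [12, 24], (b) ∧ (c)`) — the planner copied them verbatim so that the Assembly `closes`
composes syntactically. Three sorry-free consequences, recorded for the planner and the ledger:

* `diluteDWavePairsCondense_of_not_boundCoherentDWavePairs` — if crux #3 fails (no `U` in the
  window binds a `d`-coherent pair uniformly in `L`), crux #4 holds VACUOUSLY at every `U` of the
  window: a refutation of item stmt-HubbardSuperconductivity-10770 closes item
  stmt-HubbardSuperconductivity-10771 by this one-line theorem;
* `boundCoherentDWavePairs_of_not_diluteDWavePairsCondense` — contrapositive: any refutation of
  crux #4 is a proof of crux #3 (it must exhibit a `U ∈ [12, 24]` at which (b) and (c) hold);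
* `boundCoherentDWavePairs_or_diluteDWavePairsCondense` — at least one of the two open cruxes of
  the route is TRUE; the route's open content is their conjunction (with crux #2), never #4 alone.

Hence the truth value of crux #4 is undecidable in the tree before crux #3 is settled: `¬#3 ⇒ #4`
outright, and `#3` at a witness `U₀` turns #4 at `U₀` (given (a)) into the summit's matrix
`∃ δ ∈ (0, 1/2), HasDWavePairFieldLROAt U₀ δ` (normal form:
`diluteDWavePairsCondense_iff_everyGSOrder`, `Theorems/ParentFirstSMADiluteDWavePairsCondenseNormalForm`).
Pure logic on the literal route terms; no definition is introduced. [folklore]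
-/

-- the mandated namespace `Summit.<Summit>.<Problem>.Theorems` repeats `HubbardSuperconductivity`
-- (single-problem summit, D-0017), which the `dupNamespace` linter flags on every declaration
set_option linter.dupNamespace false

namespace Summit.HubbardSuperconductivity.HubbardSuperconductivity.Theorems.ParentFirstSMA

open Summit.HubbardSuperconductivity.HubbardSuperconductivity.Theses.ParentFirstSMA

/-- **Crux #4 from the failure of crux #3.** If `BoundCoherentDWavePairs` is false — no
`U ∈ [12, 24]` has BOTH uniform two-hole binding (b) AND uniform `d_{x²-y²}` pair coherence (c) —
then `DiluteDWavePairsCondense` holds, vacuously: at each `U` of the window its hypotheses (b), (c)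
would witness crux #3. The half-filled charge-gap hypothesis (a) is not used. [folklore] -/
theorem diluteDWavePairsCondense_of_not_boundCoherentDWavePairs : ¬ Summit.HubbardSuperconductivity.HubbardSuperconductivity.Theses.ParentFirstSMA.BoundCoherentDWavePairs → Summit.HubbardSuperconductivity.HubbardSuperconductivity.Theses.ParentFirstSMA.DiluteDWavePairsCondense := by
  intro h U hU12 hU24 _ hb hc
  exact absurd ⟨U, hU12, hU24, hb, hc⟩ h

/-- **Refuting crux #4 proves crux #3.** Any proof of `¬ DiluteDWavePairsCondense` yields
`BoundCoherentDWavePairs`: a counterexample `U` to the BEC bridge lies in `[12, 24]` and satisfies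
(b) and (c) uniformly in even `L`, which is literally crux #3's matrix at `U`. [folklore] -/
theorem boundCoherentDWavePairs_of_not_diluteDWavePairsCondense : ¬ Summit.HubbardSuperconductivity.HubbardSuperconductivity.Theses.ParentFirstSMA.DiluteDWavePairsCondense → Summit.HubbardSuperconductivity.HubbardSuperconductivity.Theses.ParentFirstSMA.BoundCoherentDWavePairs := by
  intro h
  by_contra h'
  exact h (diluteDWavePairsCondense_of_not_boundCoherentDWavePairs h')

/-- **Dichotomy.** Of the two open cruxes #3 `BoundCoherentDWavePairs` and #4
`DiluteDWavePairsCondense` of route `ParentFirstSMA`, at least one is true (classically). The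
route needs both; this records that #4 carries content only at the witnesses of #3. [folklore] -/
theorem boundCoherentDWavePairs_or_diluteDWavePairsCondense : Summit.HubbardSuperconductivity.HubbardSuperconductivity.Theses.ParentFirstSMA.BoundCoherentDWavePairs ∨ Summit.HubbardSuperconductivity.HubbardSuperconductivity.Theses.ParentFirstSMA.DiluteDWavePairsCondense := by
  by_cases h : BoundCoherentDWavePairs
  · exact Or.inl h
  · exact Or.inr (diluteDWavePairsCondense_of_not_boundCoherentDWavePairs h)

end Summit.HubbardSuperconductivity.HubbardSuperconductivity.Theorems.ParentFirstSMA
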